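import Mathlib
import HarnessLib
import Summits.KontsevichZagierPeriods.KontsevichZagierPeriods.Theses.LinRedNormalForm
import Summits.KontsevichZagierPeriods.KontsevichZagierPeriods.Theorems.LinRedNormalFormDihedralNormalFormStubAtomReduction
import Summits.KontsevichZagierPeriods.KontsevichZagierPeriods.Theorems.LinRedNormalFormDihedralNormalFormStubUnnestingThree
import Summits.KontsevichZagierPeriods.KontsevichZagierPeriods.Theorems.LinRedNormalFormDihedralNormalFormDimLeThree
import Summits.KontsevichZagierPeriods.KontsevichZagierPeriods.Theorems.LinRedNormalFormDihedralNormalFormStubProductClosure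
import Summits.KontsevichZagierPeriods.KontsevichZagierPeriods.Theorems.LinRedNormalFormDihedralNormalFormStubProductSplit

/-!
# `DihedralNormalForm` from unnesting of NON-PRODUCT atoms in dimension `≥ 4` (line `torus-descent-sum-shadow`, closing v5)

Version 5 of the conditional closing theorem (lead c1, 2026-08-16): the hypothesis is WEAKER than in
`…OfUnnestingHigh` (`dihedralNormalForm_of_unnestingHigh`, p116934) — it is only required for
atoms that are not PRODUCT atoms (some seam `p`, `0 < p < k`, is straddled by no active chord), and
its target is enlarged by the product atoms; product atoms are reduced by the landed
`stub_productSplit` (p120401: a product atom is congruent to `KZ.of s₁ * KZ.of s₂` for two atoms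
of dimensions `p, k - p < k`) and `stub_productClosure` (p84815, line tame-bv-stokes), i.e. by the
weight-preserving cubical product maps of Brown–Carr–Schneps. Example needing it: `ζ(2)² =
[□⁴, 1/((1-x₁x₂)(1-x₃x₄))]` is neither nested nor SD1-directed.

The conditional closing theorem `dihedralNormalForm_of_unnestingNonProduct` of the line
`torus-descent-sum-shadow` for the crux `DihedralNormalForm` (stmt-KontsevichZagierPeriods-3912,
route `LinRedNormalForm`): the crux is REDUCED to the residual statement `stub_unnestingHigh` —
UNNESTING IN DIMENSION `k ≥ 4`: a non-nested convergent cubical atom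
`[□ᵏ, q · xᵃ · ∏_{i ≤ j} (1 - x_{[i,j]})^{e i j}]` (two active chords of length `≥ 2` that are
`⊆`-incomparable) is congruent modulo `KZ.relations` to a `ℤ`-combination of nested atoms,
SD1-directed atoms, word atoms of dimension `k` and atoms of lower dimension. Taking that statement
(verbatim) as a hypothesis, EVERY absolutely convergent genus-zero representation
`[Δ_k, P(t) / (∏ tᵢ^{bᵢ} ∏ (1 - tᵢ)^{cᵢ} ∏_{i<j} (tᵢ - tⱼ)^{aᵢⱼ})]` is congruent modulo
`KZ.relations` to a `ℤ`-combination of MZV word representations `[Δ_w, q · ∏ ω_{εᵢ}(tᵢ)]`, i.e.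
`LinRedNormalForm.DihedralNormalForm` holds BY NAME.

The proof is the full composition of the line's landed stubs, through the nodes already landed with
the dimension-`≤ 3` corollary (`…DimLeThree`, namespace `DimLeThree`: `closure_transfer`,
`red_union`, `red_of_sub_mem`, `wAtom_red`, `sd1Atom_red`, `atomLT_red`, `nAtom_red`):
* ENTRANCE `stub_atomReduction`: the input is congruent to a combination of convergent cubical
  atoms;
* strong induction on the dimension (inside the closing proof): a NON-NESTED
  atom is unnested — by the landed `stub_unnesting_le_three` in dimension `≤ 3`, by the hypothesis
  in dimension `≥ 4` — into nested ∪ SD1-directed ∪ word ∪ lower-dimensional atoms; a NESTED atom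
  goes to word ∪ SD1-directed ∪ lower-dimensional atoms by THEOREM N `stub_nestedReduction`
  (`DimLeThree.nAtom_red`); an SD1-DIRECTED atom descends one dimension by `stub_torusDescent` and
  is re-cubed by `stub_rebaseOne` (`DimLeThree.sd1Atom_red`, induction hypothesis); a WORD atom is a
  word representation read in the cubical chart, `stub_wordAtomChart` (`DimLeThree.wAtom_red`, EXIT);
* the generator-wise congruences extend additively to the generated subgroups
  (`DimLeThree.closure_transfer`).
No definitions are introduced: the generator families, the reduction relation and the hypothesis
are parse-time notations (`WORDS`, `ATOMS⟪k⟫`, …, `RED⟪S, T⟫`, `UNNESTING_HIGH`), re-declared here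
byte-for-byte from `…DimLeThree` (notations are file-local).

References: M. Kontsevich, D. Zagier, *Periods* (2001), §1.2; F. Brown, *Multiple zeta values and
periods of moduli spaces* `M_{0,n}`, Ann. Sci. ÉNS 42 (2009), Thm 1.1 (the value-level shadow).
-/

noncomputable section

open MeasureTheory Set

namespace Summit.KontsevichZagierPeriods.DihedralNormalForm.TorusDescent

open Literature.NumberTheory.Transcendental

namespace OfUnnestingNonProduct

open DimLeThree

/-! ### Notation (parse-time abbreviations, as in `…DimLeThree`; no definitions are introduced) -/

set_option quotPrecheck false

/-- The crux's target generators: MZV word representations `[Δ_w, q · ∏ ω_{εᵢ}(tᵢ)]`. -/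
local notation "WORDS" =>
  ({x : Literature.NumberTheory.Transcendental.KZ.FormalRep | ∃ (w : ℕ) (ε : Fin w → Bool) (q : ℚ) (s : Literature.NumberTheory.Transcendental.KZ.IntegralRep w), s.domain = {t | (∀ i, 0 < t i) ∧ (∀ i, t i < 1) ∧ StrictAnti t} ∧ Set.EqOn s.integrand (fun t => (q : ℝ) * ∏ i, if ε i then 1 / (1 - t i) else 1 / t i) s.domain ∧ x = Literature.NumberTheory.Transcendental.KZ.of s} : Set KZ.FormalRep)
/-- Convergent cubical atoms of dimension `k`. -/
local notation "ATOMS⟪" k "⟫" =>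
  ({z : Literature.NumberTheory.Transcendental.KZ.FormalRep | ∃ (q : ℚ) (a : Fin k → ℕ) (e : Fin k → Fin k → ℤ) (s : Literature.NumberTheory.Transcendental.KZ.IntegralRep k), s.domain = {x : Fin k → ℝ | ∀ i, x i ∈ Set.Ioo (0:ℝ) 1} ∧ Set.EqOn s.integrand (fun x => (q : ℝ) * ((∏ i : Fin k, x i ^ a i) * ∏ i : Fin k, ∏ j : Fin k, if i ≤ j then (1 - (∏ l : Fin k, if i ≤ l ∧ l ≤ j then x l else 1)) ^ e i j else 1)) s.domain ∧ z = Literature.NumberTheory.Transcendental.KZ.of s} : Set KZ.FormalRep)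
/-- Atoms of dimension `< k`. -/
local notation "ATOMSLT⟪" k "⟫" =>
  ({z : Literature.NumberTheory.Transcendental.KZ.FormalRep | ∃ d : ℕ, d < k ∧ z ∈ {z : Literature.NumberTheory.Transcendental.KZ.FormalRep | ∃ (q : ℚ) (a : Fin d → ℕ) (e : Fin d → Fin d → ℤ) (s : Literature.NumberTheory.Transcendental.KZ.IntegralRep d), s.domain = {x : Fin d → ℝ | ∀ i, x i ∈ Set.Ioo (0:ℝ) 1} ∧ Set.EqOn s.integrand (fun x => (q : ℝ) * ((∏ i : Fin d, x i ^ a i) * ∏ i : Fin d, ∏ j : Fin d, if i ≤ j then (1 - (∏ l : Fin d, if i ≤ l ∧ l ≤ j then x l else 1)) ^ e i j else 1)) s.domain ∧ z = Literature.NumberTheory.Transcendental.KZ.of s}} : Set KZ.FormalRep)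
/-- Atoms with an `SD1` descent direction. -/
local notation "SDATOMS⟪" k "⟫" =>
  ({z : Literature.NumberTheory.Transcendental.KZ.FormalRep | ∃ (q : ℚ) (a : Fin k → ℕ) (e : Fin k → Fin k → ℤ) (s : Literature.NumberTheory.Transcendental.KZ.IntegralRep k), (∃ lam : Fin k → ℤ, (∀ l : Fin k, lam l = 0 ∨ lam l = 1 ∨ lam l = -1) ∧ (∃ p : Fin k, lam p = -1) ∧ (Finset.univ.filter (fun l : Fin k => lam l = 1)).card ≤ 1 ∧ (∀ i j : Fin k, i ≤ j → e i j ≠ 0 → (∑ l : Fin k, if i ≤ l ∧ l ≤ j then lam l else 0) = 0) ∧ (∑ l : Fin k, lam l * ((a l : ℤ) + 1)) ≠ 0) ∧ s.domain = {x : Fin k → ℝ | ∀ i, x i ∈ Set.Ioo (0:ℝ) 1} ∧ Set.EqOn s.integrand (fun x => (q : ℝ) * ((∏ i : Fin k, x i ^ a i) * ∏ i : Fin k, ∏ j : Fin k, if i ≤ j then (1 - (∏ l : Fin k, if i ≤ l ∧ l ≤ j then x l else 1)) ^ e i j else 1)) s.domain ∧ z = Literature.NumberTheory.Transcendental.KZ.of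 s} : Set KZ.FormalRep)
/-- Nested atoms. -/
local notation "NATOMS⟪" k "⟫" =>
  ({z : Literature.NumberTheory.Transcendental.KZ.FormalRep | ∃ (q : ℚ) (a : Fin k → ℕ) (e : Fin k → Fin k → ℤ) (s : Literature.NumberTheory.Transcendental.KZ.IntegralRep k), (∀ i j i' j' : Fin k, i < j → i' < j' → e i j ≠ 0 → e i' j' ≠ 0 → (i ≤ i' ∧ j' ≤ j) ∨ (i' ≤ i ∧ j ≤ j')) ∧ s.domain = {x : Fin k → ℝ | ∀ i, x i ∈ Set.Ioo (0:ℝ) 1} ∧ Set.EqOn s.integrand (fun x => (q : ℝ) * ((∏ i : Fin k, x i ^ a i) * ∏ i : Fin k, ∏ j : Fin k, if i ≤ j then (1 - (∏ l : Fin k, if i ≤ l ∧ l ≤ j then x l else 1)) ^ e i j else 1)) s.domain ∧ z = Literature.NumberTheory.Transcendental.KZ.of s} : Set KZ.FormalRep)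
/-- Product atoms: no active chord straddles some seam `p`, `0 < p < k`. -/
local notation "PATOMS⟪" k "⟫" =>
  ({z : Literature.NumberTheory.Transcendental.KZ.FormalRep | ∃ (q : ℚ) (a : Fin k → ℕ) (e : Fin k → Fin k → ℤ) (s : Literature.NumberTheory.Transcendental.KZ.IntegralRep k), (∃ p : ℕ, 0 < p ∧ p < k ∧ ∀ i j : Fin k, i ≤ j → (i : ℕ) < p → p ≤ (j : ℕ) → e i j = 0) ∧ s.domain = {x : Fin k → ℝ | ∀ i, x i ∈ Set.Ioo (0:ℝ) 1} ∧ Set.EqOn s.integrand (fun x => (q : ℝ) * ((∏ i : Fin k, x i ^ a i) * ∏ i : Fin k, ∏ j : Fin k, if i ≤ j then (1 - (∏ l : Fin k, if i ≤ l ∧ l ≤ j then x l else 1)) ^ e i j else 1)) s.domain ∧ z = Literature.NumberTheory.Transcendental.KZ.of s} : Set KZ.FormalRep)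
/-- Word atoms. -/
local notation "WATOMS⟪" k "⟫" =>
  ({z : Literature.NumberTheory.Transcendental.KZ.FormalRep | ∃ (q : ℚ) (ε : Fin k → Bool) (s : Literature.NumberTheory.Transcendental.KZ.IntegralRep k), s.domain = {x : Fin k → ℝ | ∀ i, x i ∈ Set.Ioo (0:ℝ) 1} ∧ Set.EqOn s.integrand (fun x => (q : ℝ) * ((∏ i : Fin k, x i ^ (k - 1 - (i : ℕ))) * ∏ i : Fin k, if ε i then 1 / (1 - (∏ l : Fin k, if l ≤ i then x l else 1)) else 1 / (∏ l : Fin k, if l ≤ i then x l else 1))) s.domain ∧ z = Literature.NumberTheory.Transcendental.KZ.of s} : Set KZ.FormalRep)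
/-- Generator-wise reduction modulo `KZ.relations` of the family `S` onto the family `T`. -/
local notation "RED⟪" S ", " T "⟫" =>
  (∀ x ∈ (S : Set KZ.FormalRep), ∃ c ∈ AddSubgroup.closure (T : Set KZ.FormalRep), x - c ∈ KZ.relations)
/-- The residual statement `stub_unnestingHigh` (v5) of the line: unnesting of non-product atoms in dimension `≥ 4`. -/
local notation "UNNESTING_HIGH" =>
  (∀ (k : ℕ) (q : ℚ) (a : Fin k → ℕ) (e : Fin k → Fin k → ℤ) (s : Literature.NumberTheory.Transcendental.KZ.IntegralRep k), 4 ≤ k → s.domain = {x : Fin k → ℝ | ∀ i, x i ∈ Set.Ioo (0:ℝ) 1} → Set.EqOn s.integrand (fun x => (q : ℝ) * ((∏ i : Fin k, x i ^ a i) * ∏ i : Fin k, ∏ j : Fin k, if i ≤ j then (1 - (∏ l : Fin k, if i ≤ l ∧ l ≤ j then x l else 1)) ^ e i j else 1)) s.domain → ¬ (∀ i j i' j' : Fin k, i < j → i' < j' → e i j ≠ 0 → e i' j' ≠ 0 → (i ≤ i' ∧ j' ≤ j) ∨ (i' ≤ i ∧ j ≤ j')) → ¬ (∃ p : ℕ,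 0 < p ∧ p < k ∧ ∀ i j : Fin k, i ≤ j → (i : ℕ) < p → p ≤ (j : ℕ) → e i j = 0) → ∃ m ∈ AddSubgroup.closure ({z : Literature.NumberTheory.Transcendental.KZ.FormalRep | ∃ (q : ℚ) (a : Fin k → ℕ) (e : Fin k → Fin k → ℤ) (s : Literature.NumberTheory.Transcendental.KZ.IntegralRep k), (∀ i j i' j' : Fin k, i < j → i' < j' → e i j ≠ 0 → e i' j' ≠ 0 → (i ≤ i' ∧ j' ≤ j) ∨ (i' ≤ i ∧ j ≤ j')) ∧ s.domain = {x : Fin k → ℝ | ∀ i, x i ∈ Set.Ioo (0:ℝ) 1} ∧ Set.EqOn s.integrand (fun x => (q : ℝ) * ((∏ i : Fin k, x i ^ a i) * ∏ i : Fin k, ∏ j : Fin k, if i ≤ j then (1 - (∏ l : Fin k, if i ≤ l ∧ l ≤ j then x l else 1)) ^ e i j else 1)) s.domain ∧ z = Literature.NumberTheory.Transcendental.KZ.of s} ∪ {z : Literature.NumberTheory.Transcendental.KZ.FormalRep | ∃ (q : ℚ) (a : Fin k → ℕ) (e : Fin k → Fin k → ℤ) (s : Literature.NumberTheory.Transcendental.KZ.IntegralRep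 k), (∃ lam : Fin k → ℤ, (∀ l : Fin k, lam l = 0 ∨ lam l = 1 ∨ lam l = -1) ∧ (∃ p : Fin k, lam p = -1) ∧ (Finset.univ.filter (fun l : Fin k => lam l = 1)).card ≤ 1 ∧ (∀ i j : Fin k, i ≤ j → e i j ≠ 0 → (∑ l : Fin k, if i ≤ l ∧ l ≤ j then lam l else 0) = 0) ∧ (∑ l : Fin k, lam l * ((a l : ℤ) + 1)) ≠ 0) ∧ s.domain = {x : Fin k → ℝ | ∀ i, x i ∈ Set.Ioo (0:ℝ) 1} ∧ Set.EqOn s.integrand (fun x => (q : ℝ) * ((∏ i : Fin k, x i ^ a i) * ∏ i : Fin k, ∏ j : Fin k, if i ≤ j then (1 - (∏ l : Fin k, if i ≤ l ∧ l ≤ j then x l else 1)) ^ e i j else 1)) s.domain ∧ z = Literature.NumberTheory.Transcendental.KZ.of s} ∪ {z : Literature.NumberTheory.Transcendental.KZ.FormalRep | ∃ (q : ℚ) (a : Fin k → ℕ) (e : Fin k → Fin k → ℤ) (s : Literature.NumberTheory.Transcendental.KZ.IntegralRep k), (∃ p : ℕ, 0 < p ∧ p < k ∧ ∀ i j : Fin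 k, i ≤ j → (i : ℕ) < p → p ≤ (j : ℕ) → e i j = 0) ∧ s.domain = {x : Fin k → ℝ | ∀ i, x i ∈ Set.Ioo (0:ℝ) 1} ∧ Set.EqOn s.integrand (fun x => (q : ℝ) * ((∏ i : Fin k, x i ^ a i) * ∏ i : Fin k, ∏ j : Fin k, if i ≤ j then (1 - (∏ l : Fin k, if i ≤ l ∧ l ≤ j then x l else 1)) ^ e i j else 1)) s.domain ∧ z = Literature.NumberTheory.Transcendental.KZ.of s} ∪ {z : Literature.NumberTheory.Transcendental.KZ.FormalRep | ∃ (q : ℚ) (ε : Fin k → Bool) (s : Literature.NumberTheory.Transcendental.KZ.IntegralRep k), s.domain = {x : Fin k → ℝ | ∀ i, x i ∈ Set.Ioo (0:ℝ) 1} ∧ Set.EqOn s.integrand (fun x => (q : ℝ) * ((∏ i : Fin k, x i ^ (k - 1 - (i : ℕ))) * ∏ i : Fin k, if ε i then 1 / (1 - (∏ l : Fin k, if l ≤ i then x l else 1)) else 1 / (∏ l : Fin k, if l ≤ i then x l else 1))) s.domain ∧ z = Literature.NumberTheory.Transcendental.KZ.of s} ∪ {z : Literature.NumberTheory.Transcendental.KZ.FormalRep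 | ∃ d : ℕ, d < k ∧ z ∈ {z : Literature.NumberTheory.Transcendental.KZ.FormalRep | ∃ (q : ℚ) (a : Fin d → ℕ) (e : Fin d → Fin d → ℤ) (s : Literature.NumberTheory.Transcendental.KZ.IntegralRep d), s.domain = {x : Fin d → ℝ | ∀ i, x i ∈ Set.Ioo (0:ℝ) 1} ∧ Set.EqOn s.integrand (fun x => (q : ℝ) * ((∏ i : Fin d, x i ^ a i) * ∏ i : Fin d, ∏ j : Fin d, if i ≤ j then (1 - (∏ l : Fin d, if i ≤ l ∧ l ≤ j then x l else 1)) ^ e i j else 1)) s.domain ∧ z = Literature.NumberTheory.Transcendental.KZ.of s}}), Literature.NumberTheory.Transcendental.KZ.of s - m ∈ Literature.NumberTheory.Transcendental.KZ.relations : Prop)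

set_option quotPrecheck true

/-! ### Product atoms -/

/-- Membership in `relations ⊔ closure T` is the same as reduction onto `T`. -/
theorem red_iff_mem_sup {T : Set KZ.FormalRep} {x : KZ.FormalRep} :
    (∃ c ∈ AddSubgroup.closure T, x - c ∈ KZ.relations) ↔
      x ∈ KZ.relations ⊔ AddSubgroup.closure T := by
  constructor
  · rintro ⟨c, hc, hxc⟩
    exact AddSubgroup.mem_sup.mpr ⟨x - c, hxc, c, hc, by abel⟩
  · intro hx
    obtain ⟨y, hy, c, hc, rfl⟩ := AddSubgroup.mem_sup.mp hx
    exact ⟨c, hc, by simpa using hy⟩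

/-- PRODUCT atoms of dimension `k` reduce to words, given the induction hypothesis in all
dimensions `< k`: split (`stub_productSplit`), reduce both factors, multiply
(`stub_productClosure`). -/
theorem pAtom_red (k : ℕ) (IH : ∀ d < k, RED⟪ATOMS⟪d⟫, WORDS⟫) : RED⟪PATOMS⟪k⟫, WORDS⟫ := by
  rintro z ⟨q, a, e, s, ⟨p, hp0, hpk, hseam⟩, hdom, hint, rfl⟩
  obtain ⟨d₁, d₂, s₁, s₂, hd₁, hd₂, h₁, h₂, hrel⟩ :=
    stub_productSplit k q a e s p hp0 hpk hdom hint hseam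
  have m₁ := red_iff_mem_sup.mp (IH d₁ hd₁ _ h₁)
  have m₂ := red_iff_mem_sup.mp (IH d₂ hd₂ _ h₂)
  have hprod := TameBVStokes.stub_productClosure d₁ d₂ s₁ s₂ m₁ m₂
  rw [← KZ.of_mul_of] at hprod
  exact red_of_sub_mem hrel (red_iff_mem_sup.mpr hprod)

/-- **`DihedralNormalForm` from unnesting of non-product atoms in dimension `≥ 4`** (conditional
closing theorem of the line `torus-descent-sum-shadow`, v5; weaker hypothesis than
`dihedralNormalForm_of_unnestingHigh`). If every convergent cubical atom of dimension `k ≥ 4` that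
is neither nested nor a product atom is congruent modulo `KZ.relations` to a `ℤ`-combination of
nested, SD1-directed, product, word and lower-dimensional atoms (the residual statement
`stub_unnestingHigh`, v5 signature, verbatim), then `LinRedNormalForm.DihedralNormalForm` holds.
Proof: `stub_atomReduction`, then the strong induction on the dimension (inside the proof), extended additively.
[cite: KontsevichZagier2001, §1.2] -/
theorem dihedralNormalForm_of_unnestingNonProduct : (∀ (k : ℕ) (q : ℚ) (a : Fin k → ℕ) (e : Fin k → Fin k → ℤ) (s : Literature.NumberTheory.Transcendental.KZ.IntegralRep k), 4 ≤ k → s.domain = {x : Fin k → ℝ | ∀ i, x i ∈ Set.Ioo (0:ℝ) 1} → Set.EqOn s.integrand (fun x => (q : ℝ) * ((∏ i : Fin k, x i ^ a i) * ∏ i : Fin k, ∏ j : Fin k, if i ≤ j then (1 - (∏ l : Fin k, if i ≤ l ∧ l ≤ j then x l else 1)) ^ e i j else 1)) s.domain → ¬ (∀ i j i' j' : Fin k, i < j → i' < j' → e i j ≠ 0 → e i' j' ≠ 0 → (i ≤ i' ∧ j' ≤ j) ∨ (i' ≤ i ∧ j ≤ j')) → ¬ (∃ p : ℕ, 0 <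 p ∧ p < k ∧ ∀ i j : Fin k, i ≤ j → (i : ℕ) < p → p ≤ (j : ℕ) → e i j = 0) → ∃ m ∈ AddSubgroup.closure ({z : Literature.NumberTheory.Transcendental.KZ.FormalRep | ∃ (q : ℚ) (a : Fin k → ℕ) (e : Fin k → Fin k → ℤ) (s : Literature.NumberTheory.Transcendental.KZ.IntegralRep k), (∀ i j i' j' : Fin k, i < j → i' < j' → e i j ≠ 0 → e i' j' ≠ 0 → (i ≤ i' ∧ j' ≤ j) ∨ (i' ≤ i ∧ j ≤ j')) ∧ s.domain = {x : Fin k → ℝ | ∀ i, x i ∈ Set.Ioo (0:ℝ) 1} ∧ Set.EqOn s.integrand (fun x => (q : ℝ) * ((∏ i : Fin k, x i ^ a i) * ∏ i : Fin k, ∏ j : Fin k, if i ≤ j then (1 - (∏ l : Fin k, if i ≤ l ∧ l ≤ j then x l else 1)) ^ e i j else 1)) s.domain ∧ z = Literature.NumberTheory.Transcendental.KZ.of s} ∪ {z : Literature.NumberTheory.Transcendental.KZ.FormalRep | ∃ (q : ℚ) (a : Fin k → ℕ) (e : Fin k → Fin k → ℤ) (s : Literature.NumberTheory.Transcendental.KZ.IntegralRep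 k), (∃ lam : Fin k → ℤ, (∀ l : Fin k, lam l = 0 ∨ lam l = 1 ∨ lam l = -1) ∧ (∃ p : Fin k, lam p = -1) ∧ (Finset.univ.filter (fun l : Fin k => lam l = 1)).card ≤ 1 ∧ (∀ i j : Fin k, i ≤ j → e i j ≠ 0 → (∑ l : Fin k, if i ≤ l ∧ l ≤ j then lam l else 0) = 0) ∧ (∑ l : Fin k, lam l * ((a l : ℤ) + 1)) ≠ 0) ∧ s.domain = {x : Fin k → ℝ | ∀ i, x i ∈ Set.Ioo (0:ℝ) 1} ∧ Set.EqOn s.integrand (fun x => (q : ℝ) * ((∏ i : Fin k, x i ^ a i) * ∏ i : Fin k, ∏ j : Fin k, if i ≤ j then (1 - (∏ l : Fin k, if i ≤ l ∧ l ≤ j then x l else 1)) ^ e i j else 1)) s.domain ∧ z = Literature.NumberTheory.Transcendental.KZ.of s} ∪ {z : Literature.NumberTheory.Transcendental.KZ.FormalRep | ∃ (q : ℚ) (a : Fin k → ℕ) (e : Fin k → Fin k → ℤ) (s : Literature.NumberTheory.Transcendental.KZ.IntegralRep k), (∃ p : ℕ, 0 < p ∧ p < k ∧ ∀ i j : Fin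 k, i ≤ j → (i : ℕ) < p → p ≤ (j : ℕ) → e i j = 0) ∧ s.domain = {x : Fin k → ℝ | ∀ i, x i ∈ Set.Ioo (0:ℝ) 1} ∧ Set.EqOn s.integrand (fun x => (q : ℝ) * ((∏ i : Fin k, x i ^ a i) * ∏ i : Fin k, ∏ j : Fin k, if i ≤ j then (1 - (∏ l : Fin k, if i ≤ l ∧ l ≤ j then x l else 1)) ^ e i j else 1)) s.domain ∧ z = Literature.NumberTheory.Transcendental.KZ.of s} ∪ {z : Literature.NumberTheory.Transcendental.KZ.FormalRep | ∃ (q : ℚ) (ε : Fin k → Bool) (s : Literature.NumberTheory.Transcendental.KZ.IntegralRep k), s.domain = {x : Fin k → ℝ | ∀ i, x i ∈ Set.Ioo (0:ℝ) 1} ∧ Set.EqOn s.integrand (fun x => (q : ℝ) * ((∏ i : Fin k, x i ^ (k - 1 - (i : ℕ))) * ∏ i : Fin k, if ε i then 1 / (1 - (∏ l : Fin k, if l ≤ i then x l else 1)) else 1 / (∏ l : Fin k, if l ≤ i then x l else 1))) s.domain ∧ z = Literature.NumberTheory.Transcendental.KZ.of s} ∪ {z : Literature.NumberTheory.Transcendental.KZ.FormalRep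 | ∃ d : ℕ, d < k ∧ z ∈ {z : Literature.NumberTheory.Transcendental.KZ.FormalRep | ∃ (q : ℚ) (a : Fin d → ℕ) (e : Fin d → Fin d → ℤ) (s : Literature.NumberTheory.Transcendental.KZ.IntegralRep d), s.domain = {x : Fin d → ℝ | ∀ i, x i ∈ Set.Ioo (0:ℝ) 1} ∧ Set.EqOn s.integrand (fun x => (q : ℝ) * ((∏ i : Fin d, x i ^ a i) * ∏ i : Fin d, ∏ j : Fin d, if i ≤ j then (1 - (∏ l : Fin d, if i ≤ l ∧ l ≤ j then x l else 1)) ^ e i j else 1)) s.domain ∧ z = Literature.NumberTheory.Transcendental.KZ.of s}}), Literature.NumberTheory.Transcendental.KZ.of s - m ∈ Literature.NumberTheory.Transcendental.KZ.relations) → Summit.KontsevichZagierPeriods.KontsevichZagierPeriods.Theses.LinRedNormalForm.DihedralNormalForm := by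
  intro hU
  have atom_red : ∀ k : ℕ, RED⟪ATOMS⟪k⟫, WORDS⟫ := by
      intro k
      induction k using Nat.strong_induction_on with
      | _ k IH =>
        rintro z ⟨q, a, e, s, hdom, hint, rfl⟩
        by_cases hN : (∀ i j i' j' : Fin k, i < j → i' < j' → e i j ≠ 0 → e i' j' ≠ 0 →
            (i ≤ i' ∧ j' ≤ j) ∨ (i' ≤ i ∧ j ≤ j'))
        · exact nAtom_red k IH _ ⟨q, a, e, s, hN, hdom, hint, rfl⟩
        · by_cases hP : (∃ p : ℕ, 0 < p ∧ p < k ∧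
              ∀ i j : Fin k, i ≤ j → (i : ℕ) < p → p ≤ (j : ℕ) → e i j = 0)
          · exact pAtom_red k IH _ ⟨q, a, e, s, hP, hdom, hint, rfl⟩
          · by_cases hk : k ≤ 3
            · have h4 : RED⟪NATOMS⟪k⟫ ∪ SDATOMS⟪k⟫ ∪ WATOMS⟪k⟫ ∪ ATOMSLT⟪k⟫, WORDS⟫ :=
                red_union (red_union (red_union (nAtom_red k IH) (sd1Atom_red k IH)) (wAtom_red k))
                  (atomLT_red k IH)
              obtain ⟨m, hm, hsm⟩ := stub_unnesting_le_three k q a e s hk hdom hint hN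
              exact red_of_sub_mem hsm (closure_transfer h4 m hm)
            · have h5 : RED⟪NATOMS⟪k⟫ ∪ SDATOMS⟪k⟫ ∪ PATOMS⟪k⟫ ∪ WATOMS⟪k⟫ ∪ ATOMSLT⟪k⟫, WORDS⟫ :=
                red_union (red_union (red_union (red_union (nAtom_red k IH) (sd1Atom_red k IH))
                  (pAtom_red k IH)) (wAtom_red k)) (atomLT_red k IH)
              obtain ⟨m, hm, hsm⟩ := hU k q a e s (by omega) hdom hint hN hP
              exact red_of_sub_mem hsm (closure_transfer h5 m hm)
  intro k r p a b c hdom hint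
  obtain ⟨m, hm, hrm⟩ := stub_atomReduction k r p a b c hdom hint
  exact DimLeThree.red_of_sub_mem hrm (DimLeThree.closure_transfer (atom_red k) m hm)

end OfUnnestingNonProduct

end Summit.KontsevichZagierPeriods.DihedralNormalForm.TorusDescent
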